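import Mathlib.Algebra.MvPolynomial.PDeriv
import Mathlib.RingTheory.MvPolynomial.Homogeneous
import Mathlib.LinearAlgebra.Span.Basic
import HarnessLib

/-!
# Route `DepthWindow`, g8 — partial-derivative calculus for the negative rung `¬ HomRel 1 1`

Nisan–Wigderson's partial-derivative method [cite: NisanWigderson1996, Thm. 1], in the form needed
to refute the block lemma `HomRel 1 1` of `Theorems/DepthWindowHomRel.lean` (crux item
`HomSubReach` of route `DepthWindow`): iterated partial derivatives `dlist L = ∂_{s₁} ∘ ⋯ ∘ ∂_{sᵣ}`
along a list of variables, the Leibniz rule for a `Finset` product, and the two facts the method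
rests on —

* (upper bound) every iterated derivative of order `r` of a product `∏_{j ∈ A} ℓ_j` of polynomials
  with CONSTANT first partials (affine forms) lies in the span of the `≤ 2^{|A|}` sub-products
  `∏_{j ∈ B} ℓ_j`, `B ⊆ A`, `|B| + r = |A|` (`dlist_prod_mem_span`, `card_subprods_le`);
* (lower bound side, monomial calculus) the derivative of a square-free monomial
  `xmon T = ∏_{t ∈ T} X_t` along a duplicate-free list `L` is `xmon (T ∖ L)` if `L ⊆ T` and `0`
  otherwise (`dlist_xmon`), and `coeff (ind U) (xmon T) = [T = U]` (`coeff_ind_xmon`).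

Pure `MvPolynomial` algebra over a commutative ring; no circuits here.  Used by
`Theorems/DepthWindowHomDepthOne.lean` and `Theorems/DepthWindowHomRelOneOne.lean`.
Nothing in this file bears on `VP ≠ VNP`.

[cite: NisanWigderson1996, Thm. 1] [cite: Burgisser2000, Def. 2.1]
-/

set_option linter.dupNamespace false

namespace Summit.ValiantsHypothesis.ValiantsHypothesis.Theorems.DepthWindow

open MvPolynomial

variable {σ : Type*} {R : Type*} [CommRing R]

/-! ### Iterated partial derivatives along a list of variables -/

/-- `dlist [s₁, …, sᵣ] p = ∂_{s₁} (∂_{s₂} ( ⋯ (∂_{sᵣ} p)))`. [cite: NisanWigderson1996, Thm. 1] -/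
noncomputable def dlist : List σ → MvPolynomial σ R → MvPolynomial σ R
  | [], p => p
  | s :: L, p => pderiv s (dlist L p)

/-- Unfolding `dlist` on the empty list. -/
@[simp] theorem dlist_nil (p : MvPolynomial σ R) : dlist [] p = p := rfl

/-- Unfolding `dlist` on a cons. -/
@[simp] theorem dlist_cons (s : σ) (L : List σ) (p : MvPolynomial σ R) :
    dlist (s :: L) p = pderiv s (dlist L p) := rfl

/-- `dlist L 0 = 0`. -/
@[simp] theorem dlist_zero : ∀ L : List σ, dlist L (0 : MvPolynomial σ R) = 0
  | [] => rfl
  | s :: L => by rw [dlist_cons, dlist_zero L, map_zero]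

/-- `dlist L` is additive. -/
theorem dlist_add : ∀ (L : List σ) (p q : MvPolynomial σ R),
    dlist L (p + q) = dlist L p + dlist L q
  | [], _, _ => rfl
  | s :: L, p, q => by rw [dlist_cons, dlist_add L, map_add]; rfl

/-- `dlist L` commutes with scalars. -/
theorem dlist_smul : ∀ (L : List σ) (c : R) (p : MvPolynomial σ R),
    dlist L (c • p) = c • dlist L p
  | [], _, _ => rfl
  | s :: L, c, p => by rw [dlist_cons, dlist_smul L, Derivation.map_smul]; rfl

/-- `dlist L` commutes with multiplication by a constant. -/
theorem dlist_C_mul (L : List σ) (c : R) (p : MvPolynomial σ R) :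
    dlist L (C c * p) = C c * dlist L p := by
  rw [C_mul', dlist_smul, C_mul']

/-- `dlist L` commutes with finite sums. -/
theorem dlist_sum {ι : Type*} (L : List σ) (s : Finset ι) (f : ι → MvPolynomial σ R) :
    dlist L (∑ i ∈ s, f i) = ∑ i ∈ s, dlist L (f i) := by
  classical
  induction s using Finset.induction_on with
  | empty => simp
  | insert a s ha ih => rw [Finset.sum_insert ha, Finset.sum_insert ha, dlist_add, ih]

/-- `dlist L` as a linear map. -/
noncomputable def dlistLin (L : List σ) : MvPolynomial σ R →ₗ[R] MvPolynomial σ R where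
  toFun := dlist L
  map_add' := dlist_add L
  map_smul' := dlist_smul L

/-- Unfolding `dlistLin`. -/
@[simp] theorem dlistLin_apply (L : List σ) (p : MvPolynomial σ R) : dlistLin L p = dlist L p := rfl

/-! ### Leibniz rule for a `Finset` product -/

/-- **Leibniz rule**: `∂_s ∏_{j∈B} ℓ_j = ∑_{j∈B} (∂_s ℓ_j) ∏_{j'∈B∖j} ℓ_{j'}`.
[cite: NisanWigderson1996, Thm. 1] -/
theorem pderiv_finset_prod {ι : Type*} [DecidableEq ι] (s : σ) (ℓ : ι → MvPolynomial σ R) :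
    ∀ B : Finset ι, pderiv s (∏ j ∈ B, ℓ j) = ∑ j ∈ B, pderiv s (ℓ j) * ∏ j' ∈ B.erase j, ℓ j' := by
  intro B
  induction B using Finset.induction_on with
  | empty => simp
  | insert a B ha ih =>
      rw [Finset.prod_insert ha, pderiv_mul, ih, Finset.sum_insert ha, Finset.erase_insert ha,
        Finset.mul_sum]
      congr 1
      refine Finset.sum_congr rfl fun j hj => ?_
      have hne : a ≠ j := fun h => ha (h ▸ hj)
      rw [Finset.erase_insert_of_ne hne, Finset.prod_insert (fun h => ha (Finset.mem_of_mem_erase h))]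
      ring

/-! ### Sub-products and the span bound -/

/-- The sub-products `∏_{j∈B} ℓ_j` over `B ⊆ A` with `|B| + m = |A|` (as a finset of polynomials). -/
noncomputable def subprods {ι : Type*} (A : Finset ι) (ℓ : ι → MvPolynomial σ R) (m : ℕ) :
    Finset (MvPolynomial σ R) := by
  classical
  exact (A.powerset.filter fun B => B.card + m = A.card).image fun B => ∏ j ∈ B, ℓ j

/-- At most `2^{|A|}` sub-products. -/
theorem card_subprods_le {ι : Type*} (A : Finset ι) (ℓ : ι → MvPolynomial σ R) (m : ℕ) :
    (subprods A ℓ m).card ≤ 2 ^ A.card := by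
  classical
  unfold subprods
  exact Finset.card_image_le.trans ((Finset.card_filter_le _ _).trans (Finset.card_powerset A).le)

/-- Membership in `subprods`. -/
theorem mem_subprods {ι : Type*} [DecidableEq ι] {A : Finset ι} {ℓ : ι → MvPolynomial σ R} {m : ℕ}
    {B : Finset ι} (hB : B ⊆ A) (hc : B.card + m = A.card) :
    ∏ j ∈ B, ℓ j ∈ subprods A ℓ m := by
  classical
  unfold subprods
  exact Finset.mem_image.mpr ⟨B, Finset.mem_filter.mpr ⟨Finset.mem_powerset.mpr hB, hc⟩, by congr⟩

/-- The full product is a sub-product of co-size `0`. -/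
theorem prod_mem_span_subprods {ι : Type*} (A : Finset ι) (ℓ : ι → MvPolynomial σ R) :
    ∏ j ∈ A, ℓ j ∈ Submodule.span R (subprods A ℓ 0 : Set (MvPolynomial σ R)) := by
  classical
  exact Submodule.subset_span (mem_subprods (Finset.Subset.refl A) (by simp))

/-- One partial derivative maps the span of the co-size-`m` sub-products into the span of the
co-size-`(m+1)` ones, provided every factor has constant first partials (affine factors).
[cite: NisanWigderson1996, Thm. 1] -/
theorem pderiv_mem_span_subprods {ι : Type*} (A : Finset ι) (ℓ : ι → MvPolynomial σ R)
    (hℓ : ∀ j s, ∃ c : R, pderiv s (ℓ j) = C c) (s : σ) {m : ℕ} {x : MvPolynomial σ R}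
    (hx : x ∈ Submodule.span R (subprods A ℓ m : Set (MvPolynomial σ R))) :
    pderiv s x ∈ Submodule.span R (subprods A ℓ (m + 1) : Set (MvPolynomial σ R)) := by
  classical
  induction hx using Submodule.span_induction with
  | mem x hx =>
      unfold subprods at hx
      obtain ⟨B, hB, rfl⟩ := Finset.mem_image.mp hx
      obtain ⟨hBA, hcard⟩ := Finset.mem_filter.mp hB
      rw [Finset.mem_powerset] at hBA
      rw [pderiv_finset_prod]
      refine Submodule.sum_mem _ fun j hj => ?_
      obtain ⟨c, hc⟩ := hℓ j s
      rw [hc, C_mul']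
      refine Submodule.smul_mem _ _ (Submodule.subset_span (mem_subprods ?_ ?_))
      · exact (Finset.erase_subset j B).trans hBA
      · rw [Finset.card_erase_of_mem hj]
        have := Finset.card_pos.mpr ⟨j, hj⟩
        omega
  | zero => rw [map_zero]; exact Submodule.zero_mem _
  | add x y _ _ hx hy => rw [map_add]; exact Submodule.add_mem _ hx hy
  | smul c x _ hx => rw [Derivation.map_smul]; exact Submodule.smul_mem _ c hx

/-- **Span bound (NW96).**  Every order-`|L|` iterated partial derivative of a product of affine
forms `∏_{j∈A} ℓ_j` lies in the span of its co-size-`|L|` sub-products.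
[cite: NisanWigderson1996, Thm. 1] -/
theorem dlist_prod_mem_span {ι : Type*} (A : Finset ι) (ℓ : ι → MvPolynomial σ R)
    (hℓ : ∀ j s, ∃ c : R, pderiv s (ℓ j) = C c) :
    ∀ L : List σ, dlist L (∏ j ∈ A, ℓ j) ∈
      Submodule.span R (subprods A ℓ L.length : Set (MvPolynomial σ R))
  | [] => prod_mem_span_subprods A ℓ
  | s :: L => by
      rw [dlist_cons, List.length_cons]
      exact pderiv_mem_span_subprods A ℓ hℓ s (dlist_prod_mem_span A ℓ hℓ L)

/-- The same with a constant factor in front. -/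
theorem dlist_C_mul_prod_mem_span {ι : Type*} (A : Finset ι) (ℓ : ι → MvPolynomial σ R)
    (hℓ : ∀ j s, ∃ c : R, pderiv s (ℓ j) = C c) (c : R) (L : List σ) :
    dlist L (C c * ∏ j ∈ A, ℓ j) ∈
      Submodule.span R (subprods A ℓ L.length : Set (MvPolynomial σ R)) := by
  rw [dlist_C_mul, C_mul']
  exact Submodule.smul_mem _ c (dlist_prod_mem_span A ℓ hℓ L)

/-! ### Square-free monomials -/

/-- The exponent vector of the square-free monomial on `T`. -/
noncomputable def ind (T : Finset σ) : σ →₀ ℕ := ∑ t ∈ T, Finsupp.single t 1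

/-- The square-free monomial `∏_{t∈T} X_t`. -/
noncomputable def xmon (T : Finset σ) : MvPolynomial σ R := ∏ t ∈ T, X t

/-- `ind T` is the indicator of `T`. -/
theorem ind_apply [DecidableEq σ] (T : Finset σ) (t : σ) : ind T t = if t ∈ T then 1 else 0 := by
  unfold ind
  rw [Finset.sum_apply']
  simp_rw [Finsupp.single_apply]
  rw [Finset.sum_ite_eq']

/-- `ind` is injective. -/
theorem ind_injective {T U : Finset σ} (h : ind T = ind U) : T = U := by
  classical
  ext t
  have := congrArg (fun f => f t) h
  simp only [ind_apply] at this
  by_cases hT : t ∈ T <;> by_cases hU : t ∈ U <;> simp_all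

/-- `xmon T = monomial (ind T) 1`. -/
theorem xmon_eq_monomial (T : Finset σ) : (xmon T : MvPolynomial σ R) = monomial (ind T) 1 := by
  classical
  unfold xmon ind
  induction T using Finset.induction_on with
  | empty => simp
  | insert a T ha ih =>
      rw [Finset.prod_insert ha, Finset.sum_insert ha, ih, X, monomial_mul, one_mul]

/-- `xmon T` is homogeneous of degree `|T|`. -/
theorem isHomogeneous_xmon (T : Finset σ) : (xmon T : MvPolynomial σ R).IsHomogeneous T.card := by
  unfold xmon
  rw [Finset.card_eq_sum_ones]
  exact IsHomogeneous.prod T (fun t => X t) (fun _ => 1) fun t _ => isHomogeneous_X R t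

/-- Coefficient extraction: `coeff (ind U) (xmon T) = [T = U]`. -/
theorem coeff_ind_xmon [DecidableEq (Finset σ)] (T U : Finset σ) :
    coeff (ind U) (xmon T : MvPolynomial σ R) = if T = U then 1 else 0 := by
  classical
  rw [xmon_eq_monomial, coeff_monomial]
  by_cases h : T = U
  · subst h; simp
  · rw [if_neg (fun h' => h (ind_injective h')), if_neg h]

/-- `∂_s (xmon T) = xmon (T ∖ s)` if `s ∈ T`, else `0`. -/
theorem pderiv_xmon [DecidableEq σ] (s : σ) (T : Finset σ) :
    pderiv s (xmon T : MvPolynomial σ R) = if s ∈ T then xmon (T.erase s) else 0 := by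
  unfold xmon
  rw [pderiv_finset_prod]
  simp_rw [pderiv_X, Pi.single_apply]
  simp_rw [ite_mul, one_mul, zero_mul]
  rw [Finset.sum_ite_eq']

/-- **Monomial calculus.**  Along a duplicate-free list `L`, `dlist L (xmon T) = xmon (T ∖ L)` if
every variable of `L` lies in `T`, and `0` otherwise. [cite: NisanWigderson1996, Thm. 1] -/
theorem dlist_xmon [DecidableEq σ] :
    ∀ (L : List σ), L.Nodup → ∀ T : Finset σ,
      dlist L (xmon T : MvPolynomial σ R) =
        if (∀ s ∈ L, s ∈ T) then xmon (T \ L.toFinset) else 0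
  | [], _, T => by simp
  | s :: L, hL, T => by
      rw [List.nodup_cons] at hL
      rw [dlist_cons, dlist_xmon L hL.2 T]
      by_cases h : ∀ s' ∈ L, s' ∈ T
      · rw [if_pos h, pderiv_xmon]
        have hiff : (∀ s' ∈ s :: L, s' ∈ T) ↔ s ∈ T := by
          rw [List.forall_mem_cons]; exact ⟨fun h' => h'.1, fun h' => ⟨h', h⟩⟩
        by_cases hs : s ∈ T
        · rw [if_pos (Finset.mem_sdiff.mpr ⟨hs, fun h' => hL.1 (List.mem_toFinset.mp h')⟩),
            if_pos (hiff.mpr hs), List.toFinset_cons, Finset.sdiff_insert]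
        · rw [if_neg (fun h' => hs (Finset.mem_sdiff.mp h').1), if_neg (fun h' => hs (hiff.mp h'))]
      · rw [if_neg h, map_zero, if_neg (fun h' => h fun s' hs' => h' s' (List.mem_cons_of_mem s hs'))]

end Summit.ValiantsHypothesis.ValiantsHypothesis.Theorems.DepthWindow
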